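/-
Copyright: derived here (Resolution Observatory cell `pub-rosobs`, carver gen 50). AI-written Lean; AI review is
weaker than expert review.  Companion file of the cell's POLYNOMIAL weighted-centre model `W(f)`: the pure-algebra core of
engine 1's LEMMA Λ₅ (THEOREM-FQ-eng1-g34 §14.5; CARVER-NOTES-eng1-g34 T19 "POLARISATION LEMMA").
Instrument — NOT a resolution theorem and NOT a statement about the invariant of [AbramovichTemkinWlodarczyk2024].
-/
import Mathlib.RingTheory.MvPolynomial.EulerIdentity
import Mathlib.Data.Nat.Factorial.Basic
import HarnessLib

/-!
# Polarisation along constant vectors: iterated directional derivatives and vanishing on a span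

`K` a commutative ring, `K[x_σ] = MvPolynomial σ K` (`σ` finite), constant vectors `b^i ∈ K^σ` (`i : ι`), and the
directional derivatives `D_{b} := Σ_x b_x ∂_x` (`dirD`), iterated along a list of vectors (`iterD`).
`Killed b k F` says: every `k`-fold iterated derivative `D_{b^{i₁}} ⋯ D_{b^{i_k}} F` vanishes ("all `k`-fold polars of `F`
at `b`-vectors vanish").

* `Killed.mul` (Leibniz bookkeeping): `Killed (a+1) u → Killed (c+1) v → Killed (a+c+1) (u·v)`;
* `killed_of_isHomogeneous`: a form of degree `n` is killed by `n+1` derivatives;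
* `aeval_eq_zero_of_killed` (**P0**): `F` homogeneous of degree `d`, `Killed b d F`, `d!` a unit ⇒ `F(Σ_i t_i b^i) = 0` for
  all `t_i` in any commutative `K`-algebra (induction on `d` via Euler's identity, Mathlib `IsHomogeneous.sum_X_mul_pderiv`);
* `killed_five_of_polar_relations` + `aeval_eq_zero_of_polar_relations` (**T19, the core of Λ₅**): `F` a quintic form,
  `P_m` forms with all triple `b`-polars zero (`Killed b 3 (P m)`), and for each `i` a relation
  `D_{b^i} F = Σ_m (g_{m,i}·P_m + γ_{m,i}·D_{b^i} P_m)` with `g_{m,i}` linear and `γ_{m,i}` quadratic forms.  THEN all 5-fold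
  `b`-polars of `F` vanish, and (if `5! = 120` is a unit) `F(Σ_i t_i b^i) = 0`.  Proof = Leibniz: four more derivatives
  distribute over the products; `g` absorbs ≤ 1, `γ` ≤ 2, and what is left on `P_m` is always a ≥ 3-fold `b`-derivative.

* `killed_of_aeval_linearForms_eq_zero` (**converse, no unit needed**): if the form `F` of degree `d` vanishes on the GENERIC span,
  `F(Σ_i t_i b^i) = 0` in the polynomial ring `K[t_ι]`, then `Killed b d F` — by the chain rule
  `∂_{t_i}(F(Σ t_j b^j)) = (D_{b^i}F)(Σ t_j b^j)` (`pderiv_aeval_linearForms`).  This is the form in which the engine obtains its hypothesis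
  (FQ §14.3: `P_m(Σ_y b^y ε_y) = 0` in `k[σ][ε_light]` ⇒ (Pol₃)), so `aeval_eq_zero_of_polar_relations'` takes (i) directly as
  "`P_m` is a cubic form with `P_m(Σ t_i b^i) = 0` in `K[t]`".

[ATW24] Abramovich–Temkin–Włodarczyk, Algebra & Number Theory 18 (2024), §5.2 (pp. 1576–1577).  CONTEXT ONLY; the lemma is
elementary commutative algebra and the formalisation is ours.
-/

namespace Literature.AlgebraicGeometry.Resolution.WeightedBlowup

open MvPolynomial

section DirD

variable {K : Type*} [CommRing K] {σ : Type*} [Fintype σ]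

/-- The directional derivative `D_b F = Σ_x b_x ∂_x F` along a constant vector `b ∈ K^σ` (ours).
[cite: AbramovichTemkinWlodarczyk2024, §5.2 (pp. 1576–1577)] -/
noncomputable def dirD (b : σ → K) (f : MvPolynomial σ K) : MvPolynomial σ K := ∑ x, b x • pderiv x f

/-- Bookkeeping lemma (ours). [cite: AbramovichTemkinWlodarczyk2024, §5.2 (pp. 1576–1577)] -/
theorem dirD_add (b : σ → K) (f g : MvPolynomial σ K) : dirD b (f + g) = dirD b f + dirD b g := by
  simp only [dirD, map_add, smul_add, Finset.sum_add_distrib]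

/-- Bookkeeping lemma (ours). [cite: AbramovichTemkinWlodarczyk2024, §5.2 (pp. 1576–1577)] -/
theorem dirD_zero (b : σ → K) : dirD b (0 : MvPolynomial σ K) = 0 := by
  simp only [dirD, map_zero, smul_zero, Finset.sum_const_zero]

/-- Bookkeeping lemma (ours). [cite: AbramovichTemkinWlodarczyk2024, §5.2 (pp. 1576–1577)] -/
theorem dirD_C (b : σ → K) (c : K) : dirD b (C c : MvPolynomial σ K) = 0 := by
  simp only [dirD, pderiv_C, smul_zero, Finset.sum_const_zero]

/-- Leibniz rule for `D_b` (ours). [cite: AbramovichTemkinWlodarczyk2024, §5.2 (pp. 1576–1577)] -/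
theorem dirD_mul (b : σ → K) (f g : MvPolynomial σ K) : dirD b (f * g) = dirD b f * g + f * dirD b g := by
  simp only [dirD, pderiv_mul, smul_add, Finset.sum_add_distrib, Finset.sum_mul, Finset.mul_sum, smul_mul_assoc,
    mul_smul_comm]

/-- `D_b` lowers the degree of a form by one (ours). [cite: AbramovichTemkinWlodarczyk2024, §5.2 (pp. 1576–1577)] -/
theorem isHomogeneous_dirD (b : σ → K) {f : MvPolynomial σ K} {n : ℕ} (hf : f.IsHomogeneous n) :
    (dirD b f).IsHomogeneous (n - 1) :=
  IsHomogeneous.sum _ _ _ fun x _ => by rw [smul_eq_C_mul]; exact hf.pderiv.C_mul _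

variable {ι : Type*}

/-- Iterated directional derivative along the list of vectors `b^{i₁}, …, b^{i_k}` (the head acts first; ours).
[cite: AbramovichTemkinWlodarczyk2024, §5.2 (pp. 1576–1577)] -/
noncomputable def iterD (b : ι → σ → K) : List ι → MvPolynomial σ K → MvPolynomial σ K
  | [], f => f
  | i :: l, f => iterD b l (dirD (b i) f)

/-- Bookkeeping lemma (ours). [cite: AbramovichTemkinWlodarczyk2024, §5.2 (pp. 1576–1577)] -/
@[simp] theorem iterD_nil (b : ι → σ → K) (f : MvPolynomial σ K) : iterD b [] f = f := rfl

/-- Bookkeeping lemma (ours). [cite: AbramovichTemkinWlodarczyk2024, §5.2 (pp. 1576–1577)] -/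
@[simp] theorem iterD_cons (b : ι → σ → K) (i : ι) (l : List ι) (f : MvPolynomial σ K) :
    iterD b (i :: l) f = iterD b l (dirD (b i) f) := rfl

/-- Bookkeeping lemma (ours). [cite: AbramovichTemkinWlodarczyk2024, §5.2 (pp. 1576–1577)] -/
theorem iterD_zero (b : ι → σ → K) (l : List ι) : iterD b l (0 : MvPolynomial σ K) = 0 := by
  induction l with
  | nil => rfl
  | cons i l ih => rw [iterD_cons, dirD_zero, ih]

/-- Bookkeeping lemma (ours). [cite: AbramovichTemkinWlodarczyk2024, §5.2 (pp. 1576–1577)] -/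
theorem iterD_add (b : ι → σ → K) (l : List ι) (f g : MvPolynomial σ K) :
    iterD b l (f + g) = iterD b l f + iterD b l g := by
  induction l generalizing f g with
  | nil => rfl
  | cons i l ih => rw [iterD_cons, iterD_cons, iterD_cons, dirD_add, ih]

/-- Bookkeeping lemma (ours). [cite: AbramovichTemkinWlodarczyk2024, §5.2 (pp. 1576–1577)] -/
theorem iterD_sum (b : ι → σ → K) (l : List ι) {μ : Type*} (s : Finset μ) (f : μ → MvPolynomial σ K) :
    iterD b l (∑ m ∈ s, f m) = ∑ m ∈ s, iterD b l (f m) := by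
  classical
  induction s using Finset.induction_on with
  | empty => rw [Finset.sum_empty, Finset.sum_empty, iterD_zero]
  | insert a s ha ih => rw [Finset.sum_insert ha, Finset.sum_insert ha, iterD_add, ih]

/-- `Killed b k F`: every `k`-fold iterated derivative of `F` along `b`-vectors vanishes — "all `k`-fold polars of `F` at
the vectors `b^i` are zero" (ours). [cite: AbramovichTemkinWlodarczyk2024, §5.2 (pp. 1576–1577)] -/
def Killed (b : ι → σ → K) (k : ℕ) (f : MvPolynomial σ K) : Prop := ∀ l : List ι, l.length = k → iterD b l f = 0

/-- Bookkeeping lemma (ours). [cite: AbramovichTemkinWlodarczyk2024, §5.2 (pp. 1576–1577)] -/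
theorem killed_zero (b : ι → σ → K) (k : ℕ) : Killed b k (0 : MvPolynomial σ K) := fun l _ => iterD_zero b l

/-- Bookkeeping lemma (ours). [cite: AbramovichTemkinWlodarczyk2024, §5.2 (pp. 1576–1577)] -/
theorem killed_zero_iff {b : ι → σ → K} {f : MvPolynomial σ K} : Killed b 0 f ↔ f = 0 :=
  ⟨fun h => h [] rfl, fun h l hl => by rw [List.eq_nil_of_length_eq_zero hl, iterD_nil, h]⟩

/-- Bookkeeping lemma (ours). [cite: AbramovichTemkinWlodarczyk2024, §5.2 (pp. 1576–1577)] -/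
theorem Killed.add {b : ι → σ → K} {k : ℕ} {f g : MvPolynomial σ K} (hf : Killed b k f) (hg : Killed b k g) :
    Killed b k (f + g) := fun l hl => by rw [iterD_add, hf l hl, hg l hl, add_zero]

/-- Bookkeeping lemma (ours). [cite: AbramovichTemkinWlodarczyk2024, §5.2 (pp. 1576–1577)] -/
theorem Killed.sum {b : ι → σ → K} {k : ℕ} {μ : Type*} (s : Finset μ) {f : μ → MvPolynomial σ K}
    (h : ∀ m ∈ s, Killed b k (f m)) : Killed b k (∑ m ∈ s, f m) := fun l hl => by
  rw [iterD_sum]; exact Finset.sum_eq_zero fun m hm => h m hm l hl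

/-- Bookkeeping lemma (ours). [cite: AbramovichTemkinWlodarczyk2024, §5.2 (pp. 1576–1577)] -/
theorem Killed.dirD {b : ι → σ → K} {k : ℕ} {f : MvPolynomial σ K} (hf : Killed b (k + 1) f) (i : ι) :
    Killed b k (dirD (b i) f) := fun l hl => by
  rw [← iterD_cons]; exact hf (i :: l) (by rw [List.length_cons, hl])

/-- Bookkeeping lemma (ours). [cite: AbramovichTemkinWlodarczyk2024, §5.2 (pp. 1576–1577)] -/
theorem killed_succ_iff {b : ι → σ → K} {k : ℕ} {f : MvPolynomial σ K} :
    Killed b (k + 1) f ↔ ∀ i, Killed b k (dirD (b i) f) := by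
  refine ⟨fun h i => h.dirD i, fun h l hl => ?_⟩
  obtain _ | ⟨i, l⟩ := l
  · exact absurd hl (by simp)
  · rw [iterD_cons]; exact h i l (by simpa using hl)

/-- A form of degree `n` is killed by any `n + 1` directional derivatives (ours).
[cite: AbramovichTemkinWlodarczyk2024, §5.2 (pp. 1576–1577)] -/
theorem killed_of_isHomogeneous (b : ι → σ → K) {n : ℕ} {f : MvPolynomial σ K} (hf : f.IsHomogeneous n) :
    Killed b (n + 1) f := by
  induction n generalizing f with
  | zero =>
    rw [killed_succ_iff]; intro i
    rw [← totalDegree_zero_iff_isHomogeneous, totalDegree_eq_zero_iff_eq_C] at hf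
    rw [hf, dirD_C]; exact killed_zero b 0
  | succ n ih =>
    rw [killed_succ_iff]; intro i
    exact ih (by simpa using isHomogeneous_dirD (b i) hf)

/-- **Leibniz bookkeeping** (ours): if `a+1` derivatives kill `u` and `c+1` kill `v`, then `a+c+1` kill `u·v`
(in `D^{a+c+1}(uv)` every term puts `≥ a+1` derivatives on `u` or `≥ c+1` on `v`).
[cite: AbramovichTemkinWlodarczyk2024, §5.2 (pp. 1576–1577)] -/
theorem Killed.mul_of_add_eq (b : ι → σ → K) (n : ℕ) : ∀ {a c : ℕ}, a + c = n → ∀ {u v : MvPolynomial σ K},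
    Killed b (a + 1) u → Killed b (c + 1) v → Killed b (n + 1) (u * v) := by
  induction n with
  | zero =>
    intro a c hac u v hu hv
    obtain ⟨rfl, rfl⟩ : a = 0 ∧ c = 0 := ⟨by omega, by omega⟩
    rw [killed_succ_iff]; intro i
    rw [dirD_mul, killed_zero_iff.mp (hu.dirD i), killed_zero_iff.mp (hv.dirD i), zero_mul, mul_zero, add_zero]
    exact killed_zero b 0
  | succ n ih =>
    intro a c hac u v hu hv
    rw [killed_succ_iff]; intro i
    rw [dirD_mul]
    refine Killed.add ?_ ?_
    · rcases a with _ | a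
      · rw [killed_zero_iff.mp (hu.dirD i), zero_mul]; exact killed_zero b _
      · exact ih (by omega) (hu.dirD i) hv
    · rcases c with _ | c
      · rw [killed_zero_iff.mp (hv.dirD i), mul_zero]; exact killed_zero b _
      · exact ih (by omega) hu (hv.dirD i)

/-- Bookkeeping lemma (ours). [cite: AbramovichTemkinWlodarczyk2024, §5.2 (pp. 1576–1577)] -/
theorem Killed.mul {b : ι → σ → K} {a c : ℕ} {u v : MvPolynomial σ K} (hu : Killed b (a + 1) u)
    (hv : Killed b (c + 1) v) : Killed b (a + c + 1) (u * v) :=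
  Killed.mul_of_add_eq b (a + c) rfl hu hv

end DirD

section Span

variable {K : Type*} [CommRing K] {σ : Type*} [Fintype σ] {ι : Type*} [Fintype ι]

/-- Euler step (ours): `F` a form of degree `n`, `n` a unit; if every `(D_{b^i} F)(y) = 0` at `y = Σ_i t_i b^i` then
`F(y) = 0` (`n·F(y) = Σ_x y_x (∂_x F)(y) = Σ_i t_i (D_{b^i}F)(y)`). [cite: AbramovichTemkinWlodarczyk2024, §5.2 (pp. 1576–1577)] -/
theorem aeval_eq_zero_of_aeval_dirD_eq_zero {F : MvPolynomial σ K} {n : ℕ} (hF : F.IsHomogeneous n)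
    (hn : IsUnit (n : K)) {A : Type*} [CommRing A] [Algebra K A] (b : ι → σ → K) (t : ι → A)
    (hD : ∀ i, aeval (fun x => ∑ j, t j * algebraMap K A (b j x)) (dirD (b i) F) = 0) :
    aeval (fun x => ∑ j, t j * algebraMap K A (b j x)) F = 0 := by
  set y : σ → A := fun x => ∑ j, t j * algebraMap K A (b j x) with hy
  have euler := congrArg (aeval y) hF.sum_X_mul_pderiv
  rw [map_sum, map_nsmul] at euler
  simp_rw [map_mul, aeval_X] at euler
  have h1 : ∀ i, t i * aeval y (dirD (b i) F) = ∑ x, t i * algebraMap K A (b i x) * aeval y (pderiv x F) := by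
    intro i
    simp only [dirD, map_sum, Finset.mul_sum]
    refine Finset.sum_congr rfl fun x _ => ?_
    rw [map_smul, Algebra.smul_def, mul_assoc]
  have hzero : ∑ x, y x * aeval y (pderiv x F) = 0 :=
    calc ∑ x, y x * aeval y (pderiv x F)
        = ∑ x, ∑ i, t i * algebraMap K A (b i x) * aeval y (pderiv x F) :=
          Finset.sum_congr rfl fun x _ => Finset.sum_mul _ _ _
      _ = ∑ i, ∑ x, t i * algebraMap K A (b i x) * aeval y (pderiv x F) := Finset.sum_comm
      _ = ∑ i, t i * aeval y (dirD (b i) F) := Finset.sum_congr rfl fun i _ => (h1 i).symm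
      _ = 0 := Finset.sum_eq_zero fun i _ => by rw [hD i, mul_zero]
  rw [hzero] at euler
  have key : (n : K) • aeval y F = 0 := by rw [Nat.cast_smul_eq_nsmul]; exact euler.symm
  obtain ⟨u, hu⟩ := hn
  calc aeval y F = ((↑u⁻¹ : K) * (n : K)) • aeval y F := by rw [← hu, Units.inv_mul, one_smul]
    _ = (↑u⁻¹ : K) • ((n : K) • aeval y F) := mul_smul _ _ _
    _ = 0 := by rw [key, smul_zero]

/-- **P0 — vanishing on the span** (ours).  `F` a form of degree `d` with `d!` a unit of `K`; if all `d`-fold polars of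
`F` at the vectors `b^i` vanish (`Killed b d F`), then `F(Σ_i t_i b^i) = 0` for all `t_i` in any commutative `K`-algebra
(in particular in `K[t_ι]`).  Induction on `d` by the Euler step. [cite: AbramovichTemkinWlodarczyk2024, §5.2 (pp. 1576–1577)] -/
theorem aeval_eq_zero_of_killed (b : ι → σ → K) : ∀ (d : ℕ) {F : MvPolynomial σ K}, F.IsHomogeneous d →
    Killed b d F → IsUnit ((Nat.factorial d : ℕ) : K) → ∀ {A : Type*} [CommRing A] [Algebra K A] (t : ι → A),
    aeval (fun x => ∑ j, t j * algebraMap K A (b j x)) F = 0 := by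
  intro d
  induction d with
  | zero => intro F _ hK _ A _ _ t; rw [killed_zero_iff.mp hK, map_zero]
  | succ d ih =>
    intro F hF hK hunit A _ _ t
    rw [Nat.factorial_succ, Nat.cast_mul, IsUnit.mul_iff] at hunit
    exact aeval_eq_zero_of_aeval_dirD_eq_zero hF hunit.1 b t fun i =>
      ih (by simpa using isHomogeneous_dirD (b i) hF) (hK.dirD i) hunit.2 t

omit [Fintype ι] in
/-- **T19 / LEMMA Λ₅ core, part 1** (ours).  `P_m` (`m ∈ s`) with all triple `b`-polars zero, and for every `i` a
relation `D_{b^i} F = Σ_{m ∈ s} (g_{m,i}·P_m + γ_{m,i}·D_{b^i} P_m)` with `g_{m,i}` a linear and `γ_{m,i}` a quadratic form.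
Then every 5-fold `b`-polar of `F` vanishes. [cite: AbramovichTemkinWlodarczyk2024, §5.2 (pp. 1576–1577)] -/
theorem killed_five_of_polar_relations (b : ι → σ → K) {F : MvPolynomial σ K} {μ : Type*} (s : Finset μ)
    (P : μ → MvPolynomial σ K) (g γ : μ → ι → MvPolynomial σ K) (hP : ∀ m ∈ s, Killed b 3 (P m))
    (hg : ∀ m ∈ s, ∀ i, (g m i).IsHomogeneous 1) (hγ : ∀ m ∈ s, ∀ i, (γ m i).IsHomogeneous 2)
    (hF : ∀ i, dirD (b i) F = ∑ m ∈ s, (g m i * P m + γ m i * dirD (b i) (P m))) : Killed b 5 F := by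
  rw [killed_succ_iff]; intro i
  rw [hF i]
  refine Killed.sum s fun m hm => Killed.add ?_ ?_
  · exact (killed_of_isHomogeneous b (hg m hm i)).mul (hP m hm)
  · exact (killed_of_isHomogeneous b (hγ m hm i)).mul ((hP m hm).dirD i)

/-- **T19 / LEMMA Λ₅ core, part 2 — POLARISATION LEMMA** (ours).  Under the hypotheses of
`killed_five_of_polar_relations`, if `F` is a quintic form and `5! = 120` is a unit of `K` (a field of characteristic
`0` or `≥ 7`), then `F(Σ_i t_i b^i) = 0` for all `t_i` in any commutative `K`-algebra — e.g. `t_i = ` the variables of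
`K[t_ι]`. [cite: AbramovichTemkinWlodarczyk2024, §5.2 (pp. 1576–1577)] -/
theorem aeval_eq_zero_of_polar_relations (b : ι → σ → K) {F : MvPolynomial σ K} (hF5 : F.IsHomogeneous 5)
    (h120 : IsUnit ((120 : ℕ) : K)) {μ : Type*} (s : Finset μ) (P : μ → MvPolynomial σ K)
    (g γ : μ → ι → MvPolynomial σ K) (hP : ∀ m ∈ s, Killed b 3 (P m)) (hg : ∀ m ∈ s, ∀ i, (g m i).IsHomogeneous 1)
    (hγ : ∀ m ∈ s, ∀ i, (γ m i).IsHomogeneous 2)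
    (hF : ∀ i, dirD (b i) F = ∑ m ∈ s, (g m i * P m + γ m i * dirD (b i) (P m))) {A : Type*} [CommRing A]
    [Algebra K A] (t : ι → A) : aeval (fun x => ∑ j, t j * algebraMap K A (b j x)) F = 0 :=
  aeval_eq_zero_of_killed b 5 hF5 (killed_five_of_polar_relations b s P g γ hP hg hγ hF) h120 t

/-- The same in the polynomial ring `K[t_ι]`: `F(Σ_i t_i b^i) = 0` as a polynomial in the `t_i` (ours).
[cite: AbramovichTemkinWlodarczyk2024, §5.2 (pp. 1576–1577)] -/
theorem aeval_linearForms_eq_zero_of_polar_relations (b : ι → σ → K) {F : MvPolynomial σ K}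
    (hF5 : F.IsHomogeneous 5) (h120 : IsUnit ((120 : ℕ) : K)) {μ : Type*} (s : Finset μ) (P : μ → MvPolynomial σ K)
    (g γ : μ → ι → MvPolynomial σ K) (hP : ∀ m ∈ s, Killed b 3 (P m)) (hg : ∀ m ∈ s, ∀ i, (g m i).IsHomogeneous 1)
    (hγ : ∀ m ∈ s, ∀ i, (γ m i).IsHomogeneous 2)
    (hF : ∀ i, dirD (b i) F = ∑ m ∈ s, (g m i * P m + γ m i * dirD (b i) (P m))) :
    aeval (fun x => ∑ j, (X j : MvPolynomial ι K) * C (b j x)) F = 0 := by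
  simpa only [MvPolynomial.algebraMap_eq] using
    aeval_eq_zero_of_polar_relations b hF5 h120 s P g γ hP hg hγ hF (A := MvPolynomial ι K) X

/-- For the record (ours): a CUBIC with all triple `b`-polars zero vanishes on the span when `6` is a unit — one direction of
the engine's "(i) ⟺ `P_m(Σ t_i b^i) = 0`". [cite: AbramovichTemkinWlodarczyk2024, §5.2 (pp. 1576–1577)] -/
theorem aeval_eq_zero_of_killed_three (b : ι → σ → K) {P : MvPolynomial σ K} (hP3 : P.IsHomogeneous 3)
    (h6 : IsUnit ((6 : ℕ) : K)) (hP : Killed b 3 P) {A : Type*} [CommRing A] [Algebra K A] (t : ι → A) :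
    aeval (fun x => ∑ j, t j * algebraMap K A (b j x)) P = 0 :=
  aeval_eq_zero_of_killed b 3 hP3 hP h6 t

end Span


section Converse

variable {K : Type*} [CommRing K] {σ : Type*} [Fintype σ] {ι : Type*} [Fintype ι]

omit [Fintype σ] in
/-- The generic point of the span: `y_x = Σ_j t_j b^j_x ∈ K[t_ι]` (ours). [cite: AbramovichTemkinWlodarczyk2024, §5.2 (pp. 1576–1577)] -/
noncomputable def genericSpan (b : ι → σ → K) (x : σ) : MvPolynomial ι K := ∑ j, X j * C (b j x)

omit [Fintype σ] in
/-- Bookkeeping lemma (ours). [cite: AbramovichTemkinWlodarczyk2024, §5.2 (pp. 1576–1577)] -/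
theorem pderiv_genericSpan [DecidableEq ι] (b : ι → σ → K) (i : ι) (x : σ) :
    pderiv i (genericSpan b x) = C (b i x) := by
  simp only [genericSpan, map_sum, pderiv_mul, pderiv_C, mul_zero, add_zero, pderiv_X]
  rw [Finset.sum_eq_single i (fun j _ hj => by rw [Pi.single_eq_of_ne hj, zero_mul]) (fun h => absurd (Finset.mem_univ i) h),
    Pi.single_eq_same, one_mul]

/-- **Chain rule along the generic span** (ours): `∂_{t_i} F(Σ_j t_j b^j) = (D_{b^i} F)(Σ_j t_j b^j)` in `K[t_ι]`.
[cite: AbramovichTemkinWlodarczyk2024, §5.2 (pp. 1576–1577)] -/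
theorem pderiv_aeval_genericSpan [DecidableEq ι] (b : ι → σ → K) (i : ι) (F : MvPolynomial σ K) :
    pderiv i (aeval (genericSpan b) F) = aeval (genericSpan b) (dirD (b i) F) := by
  classical
  induction F using MvPolynomial.induction_on with
  | C a => rw [aeval_C, MvPolynomial.algebraMap_eq, pderiv_C, dirD_C, map_zero]
  | add p q hp hq => rw [map_add, map_add, hp, hq, dirD_add, map_add]
  | mul_X p x hp =>
    have hDX : dirD (b i) (X x : MvPolynomial σ K) = C (b i x) := by
      simp only [dirD, pderiv_X]
      rw [Finset.sum_eq_single x (fun x' _ hx' => by rw [Pi.single_eq_of_ne' hx', smul_zero])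
        (fun h => absurd (Finset.mem_univ x) h), Pi.single_eq_same, smul_eq_C_mul, mul_one]
    rw [map_mul, aeval_X, pderiv_mul, hp, pderiv_genericSpan, dirD_mul, map_add, map_mul, map_mul, aeval_X, hDX, aeval_C,
      MvPolynomial.algebraMap_eq]

omit [Fintype ι] in
/-- Bookkeeping lemma (ours): iterated derivatives lower the degree by the length of the list.
[cite: AbramovichTemkinWlodarczyk2024, §5.2 (pp. 1576–1577)] -/
theorem isHomogeneous_iterD (b : ι → σ → K) (l : List ι) {F : MvPolynomial σ K} {n : ℕ} (hF : F.IsHomogeneous n) :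
    (iterD b l F).IsHomogeneous (n - l.length) := by
  induction l generalizing F n with
  | nil => simpa using hF
  | cons i l ih =>
    rw [iterD_cons, List.length_cons]
    have h := ih (isHomogeneous_dirD (b i) hF)
    rwa [Nat.sub_sub, Nat.add_comm] at h

/-- (ours) If `F(Σ_j t_j b^j) = 0` in `K[t_ι]`, then so does every iterated derivative: `(D_{b^{i₁}}⋯D_{b^{i_k}}F)(Σ_j t_j b^j) = 0`.
[cite: AbramovichTemkinWlodarczyk2024, §5.2 (pp. 1576–1577)] -/
theorem aeval_genericSpan_iterD_eq_zero (b : ι → σ → K) (l : List ι) {F : MvPolynomial σ K}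
    (h : aeval (genericSpan b) F = 0) : aeval (genericSpan b) (iterD b l F) = 0 := by
  classical
  induction l generalizing F with
  | nil => simpa using h
  | cons i l ih =>
    rw [iterD_cons]
    exact ih (by rw [← pderiv_aeval_genericSpan, h, map_zero])

/-- **Converse of P0, no unit hypothesis** (ours): a form of degree `d` that vanishes on the GENERIC span — `F(Σ_j t_j b^j) = 0` in the
polynomial ring `K[t_ι]` — has all its `d`-fold `b`-polars zero: `Killed b d F`.  (Chain rule `d` times; a `d`-fold derivative of a degree-`d`
form is a constant, and a constant vanishing in `K[t]` is zero.) [cite: AbramovichTemkinWlodarczyk2024, §5.2 (pp. 1576–1577)] -/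
theorem killed_of_aeval_genericSpan_eq_zero (b : ι → σ → K) {F : MvPolynomial σ K} {d : ℕ} (hF : F.IsHomogeneous d)
    (h : aeval (genericSpan b) F = 0) : Killed b d F := by
  intro l hl
  have h0 : (iterD b l F).IsHomogeneous 0 := by simpa [hl] using isHomogeneous_iterD b l hF
  rw [← totalDegree_zero_iff_isHomogeneous, totalDegree_eq_zero_iff_eq_C] at h0
  have h1 := aeval_genericSpan_iterD_eq_zero b l h
  rw [h0, aeval_C, MvPolynomial.algebraMap_eq, C_eq_zero] at h1
  rw [h0, h1, map_zero]

omit [Fintype σ] in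
/-- The generic span in the shape used by `aeval_linearForms_eq_zero_of_polar_relations` (ours).
[cite: AbramovichTemkinWlodarczyk2024, §5.2 (pp. 1576–1577)] -/
theorem genericSpan_eq (b : ι → σ → K) : genericSpan b = fun x => ∑ j, (X j : MvPolynomial ι K) * C (b j x) := rfl

/-- **T19 in the engine's hypothesis form** (ours; FQ §14.3 ⇒ (Pol₃) ⇒ §14.5).  `F` a quintic form, `P_m` CUBIC forms vanishing on the generic span
(`P_m(Σ_j t_j b^j) = 0` in `K[t_ι]`), relations `D_{b^i} F = Σ_m (g_{m,i}·P_m + γ_{m,i}·D_{b^i} P_m)` with `g` linear, `γ` quadratic forms, `120` a unit.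
THEN `F(Σ_j t_j b^j) = 0` in `K[t_ι]` (and in every commutative `K`-algebra, `aeval_eq_zero_of_polar_relations`).
[cite: AbramovichTemkinWlodarczyk2024, §5.2 (pp. 1576–1577)] -/
theorem aeval_genericSpan_eq_zero_of_polar_relations (b : ι → σ → K) {F : MvPolynomial σ K} (hF5 : F.IsHomogeneous 5)
    (h120 : IsUnit ((120 : ℕ) : K)) {μ : Type*} (s : Finset μ) (P : μ → MvPolynomial σ K) (hP3 : ∀ m ∈ s, (P m).IsHomogeneous 3)
    (hP : ∀ m ∈ s, aeval (genericSpan b) (P m) = 0) (g γ : μ → ι → MvPolynomial σ K)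
    (hg : ∀ m ∈ s, ∀ i, (g m i).IsHomogeneous 1) (hγ : ∀ m ∈ s, ∀ i, (γ m i).IsHomogeneous 2)
    (hF : ∀ i, dirD (b i) F = ∑ m ∈ s, (g m i * P m + γ m i * dirD (b i) (P m))) :
    aeval (genericSpan b) F = 0 :=
  aeval_linearForms_eq_zero_of_polar_relations b hF5 h120 s P g γ
    (fun m hm => killed_of_aeval_genericSpan_eq_zero b (hP3 m hm) (hP m hm)) hg hγ hF

end Converse

end Literature.AlgebraicGeometry.Resolution.WeightedBlowup
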